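import Mathlib
import HarnessLib

/-!
# R-H ROUND 4, R4IDEA-VOJTA2 residual R-VJ2 (memo §7): Vojta's toric log-tangent lattice at an abc point `P_{a,b,c}` SPLITS —
# VERTICAL (short, `(a,b)`-free) ⊕ HORIZONTAL (`(u,v) ∈ ℤ·(b,−a) ∖ 0`, hence sup-entry `≥ 2·max(|a|,|b|)/(n(n+1))`) — in kernel form

abc-iut cell, rung LADDER-ABC:A2.RESCUE.H; seat abc-iut-rh4-id-5 (GEN 1; KEY `wake/KEY-abc-iut-rh4-id-5-R4VJ2-S7.md` 0a949e53290d325c,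
director-abc g6-D32 2026-08-27T17:58Z; desk ruling R113 «optional count-neutral typing VOJTA2 R-VJ2 §7»). SOURCE OF RECORD: this seat's
(g0) zero-card memo `plan/rescue/R-H/ROUND4/R4-R4IDEA-VOJTA2-abc-iut-rh4-id-5.md` fb3a104b047f60e3 (lens L5 VOJTA/NEVANLINNA,
«what plays the Lemma on the Logarithmic Derivative for E/ℚ?»), §2 (the computation) and §7 (the residual R-VJ2), critic word
rh4-crit-3 `ROUND4/IDEAS/crit-oddlens-zero-card-memos-abc-iut-rh4-crit-3.md` §4 (CONCUR; F2 (i)–(v) verified by hand; «R-VJ2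
support-grade»). Printed source: Vojta, *Diophantine approximation and Nevanlinna theory*, CIME LNM 2009 — Conj. 29.1 (Tautological
Conjecture, p. 214), Prop. 29.3 (Arithmetic Chain Rule, p. 216), Thm. 30.1 (the variety `Xₙ : ∏xᵢ^i + ∏yᵢ^i + ∏zᵢ^i = 0 ⊂ (ℙ²)ⁿ`,
the monomial map `φ` (30.1.1), the point `P_{a,b,c}`, p. 217) and the faithful `𝔾_m^{2n−2}`-action respecting the fibres of `φ`
(p. 218) — read first-hand on the materialised pages p0102–p0106 of `paper:doi-10-1007-978-3-642-15945-9-3`.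

WHAT IS TYPED (namespace `Summit.ABC.IUTFork.Repair.RH.Round4Vojta2`; plain `def`s over `Fin n → ℤ`, no instance, no notation,
no Literature fact; every theorem PROVED). The memo's §2 coordinatises a logarithmic vector field on `(ℙ²)ⁿ` (all coordinate
hyperplanes removed) by its integer WEIGHTS `θ = Σᵢ (αᵢ xᵢ∂_{xᵢ} + βᵢ yᵢ∂_{yᵢ} + γᵢ zᵢ∂_{zᵢ})`, `α β γ : Fin n → ℤ` (index `i : Fin n`
↔ letter `x_{i+1}` of weight `i+1` in `∏ xᵢ^i`): `torWeight n α = Σ (i+1)·αᵢ` is the eigenvalue of `θ` on `∏ xᵢ^i`; tangency to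
`Xₙ` at `P_{a,b,c}` (`c = −a−b`) is the ONE equation `a·(α−γ) + b·(β−γ) = 0` on the weights (`IsLogTangent`); `dφ(θ) = (u,v) :=
(torWeight α − torWeight γ, torWeight β − torWeight γ)` and VERTICAL means `u = v = 0` (`IsVertical`); the per-factor Euler
relations `xᵢ∂_{xᵢ} + yᵢ∂_{yᵢ} + zᵢ∂_{zᵢ} = 0` are the shifts `(α,β,γ) ↦ (α+t, β+t, γ+t)`, under which both predicates are
invariant (`isLogTangent_eulerShift_iff`, `isVertical_eulerShift_iff`), and `EulerTrivial` (`αᵢ = βᵢ = γᵢ`) is the zero class.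
PROVED: (V3)(i) of the memo — `vertical_family` (for every index `j ≠ 0` a tangent, vertical, non-Euler vector supported on
`{0, j}` with `w j = 1` and entries `≤ j+1 ≤ n`, on the `x`-letters and on the `y`-letters: `2n−2` such vectors, the cocharacters
of Vojta's torus, INDEPENDENT OF `(a,b)`), `vertical_short` (entries `≤ 2`, `n ≥ 2`); (V3)(ii) — `coprime_tangent_dichotomy` /
`horizontal_large` (for coprime `a, b`, a tangent NON-vertical vector has `(u,v) = s·(b,−a)`, `s ≠ 0`), the size face
`horizontal_height` (`2·max(|a|,|b|) ≤ n(n+1)·M` for any bound `M` on the Euler-normalised entries `|αᵢ−γᵢ|, |βᵢ−γᵢ|`),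
`horizontal_height_sq` (`max(|a|,|b|) ≤ n²·M`), `horizontal_logHeight` (`log max(|a|,|b|) ≤ 2·log n + log M` — the memo's
«`h([θ]) ≥ h([a:b]) − 2 log n`» over `ℚ`-points), the converse `horizontal_attained` (the vector `(α₁,β₁) = (b,−a)` is tangent,
non-vertical, with entries `≤ max(|a|,|b|)`), and the packaged split `lattice_split` (every tangent vector is vertical OR pays
`2·max(|a|,|b|) ≤ n(n+1)·M`). Reading (memo §2.4, recorded not asserted): at `P_{a,b,c}` the Tautological Conjecture 29.1 WITHOUT
its `gᵢ`-clause is satisfied by a vertical `x′` of height `O(log n)` (VACUOUS), and WITH the clause for `g = φ` (non-vertical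
`x′`) it reads `log max(|a|,|b|) − 2 log n ≤ N^{(1)} + ε·h + O(1)`, i.e. abc(ε) at these points — «no engine» (census datum
deciding abc-ff RC-NV-3's open clause; count-neutral here).
DELIBERATELY NOT HERE: heights on `Γₙ`/`Γ′ₙ`, metrics, the number-field version (`ℤ ↦ 𝒪_{k′}`), the rank / basis statement
for the vertical sublattice (only the `2n−2` explicit vectors are given), Pasten's per-prime lattice (tree, BY NAME:
`Literature.Barriers.ABC.Pasten.IsAdapted`, `Pasten.abc_estimate_holds`, `Pasten.exists_adapted_independent_holds` — memo §2.5: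
the toric lattice is its image under «forget which prime, keep the exponent class», which kills the Minkowski content), any
statement about abc, Szpiro, [IUTchIII] Cor. 3.12 or [IUTchIV] Thm. 1.10.
HONEST FRAMING / GUARDS: elementary statements about integer vectors, typed so the memo's §2 can be attacked in the kernel;
COUNT-NEUTRAL (documents the VOJTA2 why-none memo; no census row flips); no Literature fact is added (frozen FACT-LIST
f75a60bac22efdb6 untouched); typed ≠ proved for every locution about `Xₙ`, `φ`, `P_{a,b,c}` (the dictionary «log field ↦ weight
vector» is the memo's §2.2, ARGUED there, folklore toric geometry); nothing here asserts that abc is proved or refuted, A-PS is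
NOT abc, and no side is taken on [IUTchIII] Cor. 3.12 / [IUTchIV] Thm. 1.10 or on any author (D-0045).
[cite: Vojta2011CIME, Conj. 29.1 p. 214; Prop. 29.3 p. 216; Thm. 30.1 p. 217–218]
-/

namespace Summit.ABC.IUTFork.Repair.RH.Round4Vojta2

open Finset

/-! ## §1. The weights of a logarithmic vector field and the two predicates -/

/-- The WEIGHT `torWeight n w = Σ_{i : Fin n} (i+1)·wᵢ` — the eigenvalue of the Euler-type operator `Σᵢ wᵢ·xᵢ∂_{xᵢ}` on the
monomial `∏ᵢ xᵢ^i` (letters `x₁,…,xₙ` of weights `1,…,n`, index `i : Fin n` ↔ `x_{i+1}`; memo §2.2). [folklore] -/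
def torWeight (n : ℕ) (w : Fin n → ℤ) : ℤ := ∑ i : Fin n, (((i : ℕ) : ℤ) + 1) * w i

/-- TANGENCY of the logarithmic field `θ = (α, β, γ)` (weights on the `x`-, `y`-, `z`-letters) to Vojta's `Xₙ : ∏xᵢ^i + ∏yᵢ^i +
∏zᵢ^i = 0` at the point `P_{a,b,c}`, `c = −a−b`: `θ` multiplies the three monomials by `torWeight α`, `torWeight β`, `torWeight γ`,
whose values at `P_{a,b,c}` are `a, b, c`, so `θF(P) = αa + βb + γc = a·(α−γ) + b·(β−γ)` (memo §2.2; the single linear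
condition). [cite: Vojta2011CIME, Thm. 30.1 p. 217] -/
def IsLogTangent (a b : ℤ) (n : ℕ) (α β γ : Fin n → ℤ) : Prop :=
  a * (torWeight n α - torWeight n γ) + b * (torWeight n β - torWeight n γ) = 0

/-- VERTICALITY for the monomial map `φ = [∏xᵢ^i : ∏yᵢ^i : ∏zᵢ^i]` (30.1.1): `dφ(θ) = (u, v) = (torWeight α − torWeight γ,
torWeight β − torWeight γ)` in logarithmic coordinates on the line minus three points, and `θ` is vertical iff `u = v = 0`
(memo §2.3). [cite: Vojta2011CIME, Thm. 30.1 p. 217–218] -/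
def IsVertical (n : ℕ) (α β γ : Fin n → ℤ) : Prop :=
  torWeight n α = torWeight n γ ∧ torWeight n β = torWeight n γ

/-- The EULER class zero: `θ` is a sum of the per-factor Euler fields `xᵢ∂_{xᵢ} + yᵢ∂_{yᵢ} + zᵢ∂_{zᵢ}` (which vanish on `ℙ²`),
i.e. `αᵢ = βᵢ = γᵢ` for every `i` (memo §2.2: the lattice is `ℤ^{3n}` modulo these). [folklore] -/
def EulerTrivial (n : ℕ) (α β γ : Fin n → ℤ) : Prop := ∀ i, α i = β i ∧ β i = γ i

/-! ## §2. Bookkeeping: linearity of the weight, Euler invariance -/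

/-- `torWeight` is additive. [folklore] -/
theorem torWeight_add (n : ℕ) (w t : Fin n → ℤ) : torWeight n (w + t) = torWeight n w + torWeight n t := by
  simp only [torWeight, Pi.add_apply, mul_add, Finset.sum_add_distrib]

/-- `torWeight` respects subtraction. [folklore] -/
theorem torWeight_sub (n : ℕ) (w t : Fin n → ℤ) : torWeight n (w - t) = torWeight n w - torWeight n t := by
  simp only [torWeight, Pi.sub_apply, mul_sub, Finset.sum_sub_distrib]

/-- `torWeight 0 = 0`. [folklore] -/
theorem torWeight_zero (n : ℕ) : torWeight n 0 = 0 := by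
  simp [torWeight]

/-- The weight of a coordinate vector: `torWeight (e_{i₀}·c) = (i₀+1)·c`. [folklore] -/
theorem torWeight_single {n : ℕ} (i₀ : Fin n) (c : ℤ) :
    torWeight n (Pi.single i₀ c) = (((i₀ : ℕ) : ℤ) + 1) * c := by
  unfold torWeight
  rw [Finset.sum_eq_single i₀]
  · rw [Pi.single_eq_same]
  · intro j _ hj
    rw [Pi.single_eq_of_ne hj, mul_zero]
  · intro h
    exact absurd (Finset.mem_univ i₀) h

/-- A bound `|wᵢ| ≤ M` on the entries bounds the weight: `2·|torWeight w| ≤ n(n+1)·M` (`Σ_{i<n}(i+1) = n(n+1)/2`). [folklore] -/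
theorem two_mul_sum_weights (n : ℕ) : 2 * ∑ i : Fin n, (((i : ℕ) : ℤ) + 1) = (n : ℤ) * (n + 1) := by
  rw [Fin.sum_univ_eq_sum_range (fun i => ((i : ℤ) + 1)) n]
  induction n with
  | zero => simp
  | succ k ih => rw [Finset.sum_range_succ, mul_add, ih]; push_cast; ring

/-- `2·|torWeight n w| ≤ n(n+1)·M` whenever `|wᵢ| ≤ M` for all `i`. [folklore] -/
theorem abs_torWeight_le {n : ℕ} {w : Fin n → ℤ} {M : ℤ} (hM : ∀ i, |w i| ≤ M) :
    2 * |torWeight n w| ≤ (n : ℤ) * (n + 1) * M := by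
  have h1 : |torWeight n w| ≤ ∑ i : Fin n, (((i : ℕ) : ℤ) + 1) * M := by
    unfold torWeight
    refine (Finset.abs_sum_le_sum_abs _ _).trans (Finset.sum_le_sum fun i _ => ?_)
    rw [abs_mul, abs_of_nonneg (by positivity)]
    exact mul_le_mul_of_nonneg_left (hM i) (by positivity)
  calc 2 * |torWeight n w| ≤ 2 * ∑ i : Fin n, (((i : ℕ) : ℤ) + 1) * M := by linarith
    _ = (2 * ∑ i : Fin n, (((i : ℕ) : ℤ) + 1)) * M := by rw [← Finset.sum_mul]; ring
    _ = (n : ℤ) * (n + 1) * M := by rw [two_mul_sum_weights]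

/-- Euler invariance of tangency (F2 (ii) of the memo): shifting `(α,β,γ)` by the same `t` (adding Euler fields) does not change
`IsLogTangent`. [folklore] -/
theorem isLogTangent_eulerShift_iff (a b : ℤ) (n : ℕ) (α β γ t : Fin n → ℤ) :
    IsLogTangent a b n (α + t) (β + t) (γ + t) ↔ IsLogTangent a b n α β γ := by
  simp only [IsLogTangent, torWeight_add, add_sub_add_right_eq_sub]

/-- Euler invariance of verticality. [folklore] -/
theorem isVertical_eulerShift_iff (n : ℕ) (α β γ t : Fin n → ℤ) :
    IsVertical n (α + t) (β + t) (γ + t) ↔ IsVertical n α β γ := by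
  simp only [IsVertical, torWeight_add, add_left_inj]

/-- The Euler class zero is vertical. [folklore] -/
theorem isVertical_of_eulerTrivial {n : ℕ} {α β γ : Fin n → ℤ} (h : EulerTrivial n α β γ) : IsVertical n α β γ :=
  ⟨congrArg (torWeight n) (funext fun i => ((h i).1.trans (h i).2)),
   congrArg (torWeight n) (funext fun i => (h i).2)⟩

/-- Vertical vectors are tangent, for EVERY `(a, b)`. [folklore] -/
theorem isLogTangent_of_isVertical (a b : ℤ) {n : ℕ} {α β γ : Fin n → ℤ} (h : IsVertical n α β γ) :
    IsLogTangent a b n α β γ := by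
  unfold IsLogTangent
  rw [h.1, h.2, sub_self, mul_zero, mul_zero, add_zero]

/-- In rank `n = 0` everything is vertical; a non-vertical vector forces `0 < n`. [folklore] -/
theorem pos_of_not_isVertical {n : ℕ} {α β γ : Fin n → ℤ} (h : ¬ IsVertical n α β γ) : 0 < n := by
  rcases Nat.eq_zero_or_pos n with rfl | hn
  · exact absurd ⟨by simp [torWeight], by simp [torWeight]⟩ h
  · exact hn

/-! ## §3. (V3)(i) THE VERTICAL PART: `2n−2` short tangent vectors, independent of `(a, b)` -/

/-- **THE VERTICAL FAMILY** (memo §2.3; the cocharacters `xⱼ ↦ t·xⱼ, x₁ ↦ t^{−j}·x₁` of Vojta's faithful `𝔾_m^{2n−2}`-action,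
CIME p. 218): for every index `j : Fin n` with `j ≠ 0` there is an integer vector `w` with `w j = 1`, supported on `{0, j}`,
entries `|wᵢ| ≤ j+1 (≤ n)`, of weight `torWeight w = 0`; placed on the `x`-letters (`(w,0,0)`) or on the `y`-letters (`(0,w,0)`)
it is TANGENT at `P_{a,b,c}` FOR EVERY `(a,b)`, VERTICAL, and NOT Euler-trivial — `2n−2` vectors in all. (Their linear
independence / that they span the vertical sublattice modulo Euler is NOT typed here.) [folklore] -/
theorem vertical_family {n : ℕ} (j : Fin n) (hj : (j : ℕ) ≠ 0) (a b : ℤ) :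
    ∃ w : Fin n → ℤ, w j = 1 ∧ (∀ i, i ≠ j → (i : ℕ) ≠ 0 → w i = 0) ∧ (∀ i, |w i| ≤ ((j : ℕ) : ℤ) + 1) ∧
      torWeight n w = 0 ∧
      (IsLogTangent a b n w 0 0 ∧ IsVertical n w 0 0 ∧ ¬ EulerTrivial n w 0 0) ∧
      (IsLogTangent a b n 0 w 0 ∧ IsVertical n 0 w 0 ∧ ¬ EulerTrivial n 0 w 0) := by
  have hn : 0 < n := j.pos
  have hj0 : j ≠ (⟨0, hn⟩ : Fin n) := fun h => hj (by rw [h])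
  set w : Fin n → ℤ := Pi.single j 1 + Pi.single (⟨0, hn⟩ : Fin n) (-(((j : ℕ) : ℤ) + 1)) with hw
  have hwj : w j = 1 := by
    simp only [hw, Pi.add_apply, Pi.single_eq_same, Pi.single_eq_of_ne hj0, add_zero]
  have hw0 : torWeight n w = 0 := by
    rw [hw, torWeight_add, torWeight_single, torWeight_single]
    simp only [Nat.cast_zero, zero_add, one_mul, mul_one]
    ring
  refine ⟨w, hwj, ?_, ?_, hw0, ⟨?_, ?_, ?_⟩, ⟨?_, ?_, ?_⟩⟩
  · intro i hij hi0
    have hi0' : i ≠ (⟨0, hn⟩ : Fin n) := fun h => hi0 (by rw [h])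
    simp only [hw, Pi.add_apply, Pi.single_eq_of_ne hij, Pi.single_eq_of_ne hi0', add_zero]
  · intro i
    simp only [hw, Pi.add_apply, Pi.single_apply]
    split_ifs with h1 h2
    · exact absurd (h1.symm.trans h2) hj0
    · rw [add_zero, abs_one]
      have : (0 : ℤ) ≤ ((j : ℕ) : ℤ) := by positivity
      linarith
    · rw [zero_add, abs_neg, abs_of_nonneg (by positivity)]
    · rw [add_zero, abs_zero]
      positivity
  · simp only [IsLogTangent, hw0, torWeight_zero, sub_self, mul_zero, add_zero]
  · exact ⟨by rw [hw0, torWeight_zero], rfl⟩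
  · intro h
    have h1 := (h j).1
    rw [hwj] at h1
    exact one_ne_zero h1
  · simp only [IsLogTangent, hw0, torWeight_zero, sub_self, mul_zero, add_zero]
  · exact ⟨rfl, by rw [hw0, torWeight_zero]⟩
  · intro h
    have h1 := (h j).1
    rw [hwj] at h1
    exact zero_ne_one h1

/-- **(V3)(i) `vertical_short`** (memo §7 verbatim): for `n ≥ 2` and EVERY `(a, b)` there is a tangent, vertical, non-Euler-trivial
vector at `P_{a,b,c}` with entries `|αᵢ| ≤ 2`, `β = γ = 0` — e.g. `(α₁, α₂) = (−2, 1)`. Consequence recorded in the memo (§2.4, not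
asserted here): the Tautological Conjecture 29.1 at `P_{a,b,c}` WITHOUT its `gᵢ`-clause is satisfied by such an `x′` — vacuously.
[folklore] -/
theorem vertical_short (n : ℕ) (hn : 2 ≤ n) (a b : ℤ) :
    ∃ α β γ : Fin n → ℤ, IsLogTangent a b n α β γ ∧ IsVertical n α β γ ∧ ¬ EulerTrivial n α β γ ∧
      ∀ i, |α i| ≤ 2 ∧ β i = 0 ∧ γ i = 0 := by
  obtain ⟨w, -, -, hb, -, ⟨ht, hv, hE⟩, -⟩ := vertical_family (⟨1, by omega⟩ : Fin n) (by simp) a b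
  refine ⟨w, 0, 0, ht, hv, hE, fun i => ⟨?_, rfl, rfl⟩⟩
  have := hb i
  simp only [Nat.cast_one] at this
  linarith

/-! ## §4. (V3)(ii) THE HORIZONTAL PART: one equation among coprime integers has the primitive tangent `(b, −a)` -/

/-- **THE INTEGER HEART** (F2 (iv) of the memo): for coprime `a, b`, every integer solution `(u, v) ≠ (0, 0)` of the ONE
tangency equation `a·u + b·v = 0` is a NON-ZERO multiple of the primitive vector `(b, −a)`. [folklore] -/
theorem coprime_tangent_dichotomy {a b u v : ℤ} (hab : IsCoprime a b) (h : a * u + b * v = 0)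
    (hne : ¬ (u = 0 ∧ v = 0)) : ∃ s : ℤ, s ≠ 0 ∧ u = s * b ∧ v = -(s * a) := by
  by_cases hb : b = 0
  · subst hb
    have ha : IsUnit a := isCoprime_zero_right.mp hab
    have ha0 : a ≠ 0 := ha.ne_zero
    have hu : u = 0 := by
      have : a * u = 0 := by simpa using h
      exact (mul_eq_zero.mp this).resolve_left ha0
    have hv : v ≠ 0 := fun hv => hne ⟨hu, hv⟩
    refine ⟨-(v * a), neg_ne_zero.mpr (mul_ne_zero hv ha0), by simp [hu], ?_⟩
    rcases Int.isUnit_iff.mp ha with rfl | rfl <;> ring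
  · have hdvd : b ∣ a * u := ⟨-v, by linarith⟩
    obtain ⟨s, hs⟩ := (hab.symm).dvd_of_dvd_mul_left hdvd
    have hsum : b * (a * s + v) = 0 := by rw [hs] at h; linarith
    have hv : a * s + v = 0 := (mul_eq_zero.mp hsum).resolve_left hb
    refine ⟨s, ?_, by rw [hs]; ring, by linarith⟩
    rintro rfl
    exact hne ⟨by simpa using hs, by simpa using hv⟩

/-- **(V3)(ii) `horizontal_large`** (memo §7 verbatim): for coprime `a, b`, a tangent vector at `P_{a,b,c}` that is NOT vertical has
`dφ(θ) = (u, v) = s·(b, −a)` with `s ∈ ℤ ∖ 0` — the horizontal part of the lattice is the line `ℤ·(b,−a)`, whose primitive vector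
carries the full height of `[a : b]` (the coordinate shadow of CIME Prop. 29.3, the Arithmetic Chain Rule, with `f = φ`).
[folklore] -/
theorem horizontal_large {a b : ℤ} (hab : IsCoprime a b) {n : ℕ} {α β γ : Fin n → ℤ}
    (ht : IsLogTangent a b n α β γ) (hnv : ¬ IsVertical n α β γ) :
    ∃ s : ℤ, s ≠ 0 ∧ torWeight n α - torWeight n γ = s * b ∧ torWeight n β - torWeight n γ = -(s * a) := by
  refine coprime_tangent_dichotomy hab ht ?_
  rintro ⟨hu, hv⟩
  exact hnv ⟨sub_eq_zero.mp hu, sub_eq_zero.mp hv⟩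

/-- **THE SIZE FACE** (memo §2.3/§7 «`|b| ≤ |u| ≤ (n(n+1)/2)·sup-entry`»): for coprime `a, b` and a tangent NON-vertical vector whose
Euler-normalised entries satisfy `|αᵢ − γᵢ| ≤ M`, `|βᵢ − γᵢ| ≤ M`, one has `2·max(|a|,|b|) ≤ n(n+1)·M`. So a non-vertical
tangent vector at `P_{a,b,c}` is LARGE: no «partially horizontal» short vectors exist. [folklore] -/
theorem horizontal_height {a b : ℤ} (hab : IsCoprime a b) {n : ℕ} {α β γ : Fin n → ℤ}
    (ht : IsLogTangent a b n α β γ) (hnv : ¬ IsVertical n α β γ) {M : ℤ}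
    (hM : ∀ i, |α i - γ i| ≤ M ∧ |β i - γ i| ≤ M) :
    2 * max |a| |b| ≤ (n : ℤ) * (n + 1) * M := by
  obtain ⟨s, hs, hu, hv⟩ := horizontal_large hab ht hnv
  have hs1 : 1 ≤ |s| := Int.one_le_abs hs
  have hU : 2 * |torWeight n α - torWeight n γ| ≤ (n : ℤ) * (n + 1) * M := by
    rw [← torWeight_sub]
    exact abs_torWeight_le fun i => by simpa only [Pi.sub_apply] using (hM i).1
  have hV : 2 * |torWeight n β - torWeight n γ| ≤ (n : ℤ) * (n + 1) * M := by
    rw [← torWeight_sub]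
    exact abs_torWeight_le fun i => by simpa only [Pi.sub_apply] using (hM i).2
  rw [hu, abs_mul] at hU
  rw [hv, abs_neg, abs_mul] at hV
  have hb : |b| ≤ |s| * |b| := le_mul_of_one_le_left (abs_nonneg b) hs1
  have ha : |a| ≤ |s| * |a| := le_mul_of_one_le_left (abs_nonneg a) hs1
  rcases le_total |a| |b| with h | h
  · rw [max_eq_right h]; linarith
  · rw [max_eq_left h]; linarith

/-- The same face with the round constant `n²`: `max(|a|,|b|) ≤ n²·M`. [folklore] -/
theorem horizontal_height_sq {a b : ℤ} (hab : IsCoprime a b) {n : ℕ} {α β γ : Fin n → ℤ}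
    (ht : IsLogTangent a b n α β γ) (hnv : ¬ IsVertical n α β γ) {M : ℤ}
    (hM : ∀ i, |α i - γ i| ≤ M ∧ |β i - γ i| ≤ M) :
    max |a| |b| ≤ (n : ℤ) ^ 2 * M := by
  have h := horizontal_height hab ht hnv hM
  have hn : 0 < n := pos_of_not_isVertical hnv
  have hM0 : 0 ≤ M := (abs_nonneg _).trans (hM ⟨0, hn⟩).1
  have hn1 : (1 : ℤ) ≤ n := by exact_mod_cast hn
  have hnM : (0 : ℤ) ≤ (n : ℤ) * M := mul_nonneg (by positivity) hM0
  have hprod : (0 : ℤ) ≤ ((n : ℤ) - 1) * ((n : ℤ) * M) := mul_nonneg (by linarith) hnM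
  have key : (n : ℤ) * (n + 1) * M + ((n : ℤ) - 1) * ((n : ℤ) * M) = 2 * ((n : ℤ) ^ 2 * M) := by ring
  linarith

/-- **THE HEIGHT READING** (memo §2.3 «`h([θ]) ≥ h([b : −a]) − 2 log n`», over `ℚ`-points): for coprime `a, b`, a tangent
NON-vertical vector with Euler-normalised entries bounded by `M` satisfies `log max(|a|,|b|) ≤ 2·log n + log M`. [folklore] -/
theorem horizontal_logHeight {a b : ℤ} (hab : IsCoprime a b) {n : ℕ} {α β γ : Fin n → ℤ}
    (ht : IsLogTangent a b n α β γ) (hnv : ¬ IsVertical n α β γ) {M : ℤ}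
    (hM : ∀ i, |α i - γ i| ≤ M ∧ |β i - γ i| ≤ M) :
    Real.log ((max |a| |b| : ℤ) : ℝ) ≤ 2 * Real.log (n : ℝ) + Real.log (M : ℝ) := by
  have h := horizontal_height_sq hab ht hnv hM
  have hn : 0 < n := pos_of_not_isVertical hnv
  have hmax1 : (1 : ℤ) ≤ max |a| |b| := by
    rcases hab.ne_zero_or_ne_zero with h0 | h0
    · exact (Int.one_le_abs h0).trans (le_max_left _ _)
    · exact (Int.one_le_abs h0).trans (le_max_right _ _)
  have hM1 : (1 : ℤ) ≤ (n : ℤ) ^ 2 * M := hmax1.trans h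
  have hnR : (0 : ℝ) < (n : ℝ) := by exact_mod_cast hn
  have hM0 : (0 : ℝ) < (M : ℝ) := by
    have hn2 : (0 : ℤ) < (n : ℤ) ^ 2 := by positivity
    have : (0 : ℤ) < M := by
      by_contra hle
      have hle' : M ≤ 0 := not_lt.mp hle
      have : (n : ℤ) ^ 2 * M ≤ 0 := mul_nonpos_of_nonneg_of_nonpos hn2.le hle'
      linarith
    exact_mod_cast this
  have hR : ((max |a| |b| : ℤ) : ℝ) ≤ ((n : ℝ)) ^ 2 * (M : ℝ) := by exact_mod_cast h
  have hpos : (0 : ℝ) < ((max |a| |b| : ℤ) : ℝ) := by exact_mod_cast (show (0 : ℤ) < max |a| |b| by linarith)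
  calc Real.log ((max |a| |b| : ℤ) : ℝ) ≤ Real.log (((n : ℝ)) ^ 2 * (M : ℝ)) := Real.log_le_log hpos hR
    _ = 2 * Real.log (n : ℝ) + Real.log (M : ℝ) := by
        rw [Real.log_mul (pow_ne_zero 2 hnR.ne') hM0.ne', Real.log_pow]
        push_cast
        ring

/-- **THE CONVERSE `horizontal_attained`** (memo §2.3: «the vector `(α₁, β₁) = (b, −a)` attains it: `λ_{2n−1} ≍ H/n²`»): for `n ≥ 1`
and `(a,b) ≠ (0,0)` the vector with `α = b·e₀`, `β = −a·e₀`, `γ = 0` (weight-`1` letters `x₁, y₁`) is tangent at `P_{a,b,c}`,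
NOT vertical, has `dφ = (b, −a)` exactly, and Euler-normalised entries `≤ max(|a|,|b|)` — so the bound of `horizontal_height` is
sharp up to the factor `n(n+1)/2`. [folklore] -/
theorem horizontal_attained {n : ℕ} (hn : 0 < n) (a b : ℤ) (hab0 : a ≠ 0 ∨ b ≠ 0) :
    ∃ α β γ : Fin n → ℤ, IsLogTangent a b n α β γ ∧ ¬ IsVertical n α β γ ∧
      torWeight n α - torWeight n γ = b ∧ torWeight n β - torWeight n γ = -a ∧
      ∀ i, |α i - γ i| ≤ max |a| |b| ∧ |β i - γ i| ≤ max |a| |b| := by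
  have hα : torWeight n (Pi.single (⟨0, hn⟩ : Fin n) b) = b := by
    rw [torWeight_single]; simp
  have hβ : torWeight n (Pi.single (⟨0, hn⟩ : Fin n) (-a)) = -a := by
    rw [torWeight_single]; simp
  refine ⟨Pi.single ⟨0, hn⟩ b, Pi.single ⟨0, hn⟩ (-a), 0, ?_, ?_, ?_, ?_, ?_⟩
  · simp only [IsLogTangent, hα, hβ, torWeight_zero, sub_zero]
    ring
  · rintro ⟨h1, h2⟩
    rw [hα, torWeight_zero] at h1
    rw [hβ, torWeight_zero] at h2
    rcases hab0 with h0 | h0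
    · exact h0 (neg_eq_zero.mp h2)
    · exact h0 h1
  · rw [hα, torWeight_zero, sub_zero]
  · rw [hβ, torWeight_zero, sub_zero]
  · intro i
    simp only [Pi.zero_apply, sub_zero, Pi.single_apply]
    split_ifs
    · exact ⟨le_max_right _ _, by rw [abs_neg]; exact le_max_left _ _⟩
    · simp only [abs_zero]
      exact ⟨(abs_nonneg a).trans (le_max_left _ _), (abs_nonneg a).trans (le_max_left _ _)⟩

/-! ## §5. R-VJ2: the split, packaged -/

/-- **R-VJ2 — THE SPLIT** (memo §2.4 «no third possibility»): for coprime `a, b`, EVERY tangent vector at `P_{a,b,c}` with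
Euler-normalised entries bounded by `M` is either VERTICAL or pays `2·max(|a|,|b|) ≤ n(n+1)·M`. Together with `vertical_family`
(`2n−2` vertical vectors of entries `≤ n`, the same for all `(a,b)`) and `horizontal_attained` (a horizontal vector of entries
`max(|a|,|b|)`), this is the memo's datum V3: the log-tangent lattice at an abc point is «torus ⊕ the point itself». Recorded, not
asserted: hence Conj. 29.1 there is vacuous without its `gᵢ`-clause and reads as abc(ε) with it (memo §2.4; count-neutral).
[folklore] -/
theorem lattice_split {a b : ℤ} (hab : IsCoprime a b) {n : ℕ} {α β γ : Fin n → ℤ}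
    (ht : IsLogTangent a b n α β γ) {M : ℤ} (hM : ∀ i, |α i - γ i| ≤ M ∧ |β i - γ i| ≤ M) :
    IsVertical n α β γ ∨ 2 * max |a| |b| ≤ (n : ℤ) * (n + 1) * M := by
  by_cases hv : IsVertical n α β γ
  · exact Or.inl hv
  · exact Or.inr (horizontal_height hab ht hv hM)

end Summit.ABC.IUTFork.Repair.RH.Round4Vojta2
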